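import Mathlib.Analysis.Calculus.ContDiff.Comp
import Mathlib.Analysis.Calculus.Deriv.Comp
import Mathlib.Analysis.Calculus.Deriv.Mul
import HarnessLib

/-!
# Leibniz rule for nested Fréchet derivatives evaluated along curves: `(d∕dt) DʲΘ(m(t))[y₁(t)]…[y_j(t)] = D^{j+1}Θ(m)[m′][y₁]…[y_j] + Σᵢ DʲΘ(m)[…, yᵢ′, …]`, `j ≤ 3`
# (Dieudonné, *Foundations of Modern Analysis*, (8.1.4) + (8.12.10); Hörmander ALPDO I, Thm. 1.1.7)

Topic `Analysis/Calculus`; namespace `Literature.Analysis.Calculus`.  THEOREMS ONLY (no `def`, no instance, no notation, no axiom, no named fact, no `sorry`).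
Generic (real normed spaces; curves `m, y₁, …, y_j : ℝ → E` with derivatives at `t`).  Written for the ANGULAR step (blueprint W6) of the (A4-iii) assembly of crux H413
(cell `pub/hodgecm-mathlib`): the flow derivative `(d∕dθ)|₀ F_X(R_θW)` of the angular primitives is, after transport to the representative ray, the `t`-derivative of nested jets
`DʲΘ(Ad_{ρ_θ}M₀)[Ad_{ρ_θ}Y₁]…` along matrix curves — base point AND slots move.  The case `y = m′` of order one is ★ p05's `BallModel.hasDerivAt_fderiv_comp_apply_of_hasDerivAt`.
* `hasDerivAt_apply_curve` (order 0), `hasDerivAt_fderiv_apply_curves` (order 1, `Θ ∈ C²`), `hasDerivAt_nestedFDeriv_two_apply_curves` (`Θ ∈ C³`),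
  `hasDerivAt_nestedFDeriv_three_apply_curves` (`Θ ∈ C⁴`); and the curve-of-operators steps `hasDerivAt_fderiv_comp_curve`, `hasDerivAt_nestedFDeriv_two_comp_curve`,
  `hasDerivAt_nestedFDeriv_three_comp_curve` (`t ↦ DʲΘ(m(t))` as a curve of nested continuous linear maps).
HONEST LABEL: calculus plumbing; pays nothing by itself (HC_CM is proved only modulo the printed citations until rung 0 closes).

## References
* [Dieudonne1960] J. Dieudonné, *Foundations of Modern Analysis* (1960), Ch. VIII §1 (8.1.4) (Leibniz for continuous multilinear maps), §12 (8.12.10).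
* [HormanderALPDO1] L. Hörmander, *The Analysis of Linear Partial Differential Operators I*, 2nd ed. (1990), Thm. 1.1.7.
-/

noncomputable section

namespace Literature.Analysis.Calculus

variable {E F : Type*} [NormedAddCommGroup E] [NormedSpace ℝ E] [NormedAddCommGroup F] [NormedSpace ℝ F]

/-- **Order zero** (chain rule): `(d∕dt) Θ(m(t)) = DΘ(m(t))[m′]` for `Θ ∈ Cⁿ`, `n ≠ 0`. [cite: Dieudonne1960, Ch. VIII §12 (8.12.10)] -/
theorem hasDerivAt_apply_curve {Θ : E → F} {n : WithTop ℕ∞} (hΘ : ContDiff ℝ n Θ) (hn : n ≠ 0) {m : ℝ → E} {m' : E} {t : ℝ}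
    (hm : HasDerivAt m m' t) : HasDerivAt (fun s => Θ (m s)) (fderiv ℝ Θ (m t) m') t :=
  ((hΘ.differentiable hn).differentiableAt.hasFDerivAt).comp_hasDerivAt t hm

/-- The curve of operators `t ↦ DΘ(m(t))` has derivative `D²Θ(m(t))[m′]` for `Θ ∈ C²`. [cite: Dieudonne1960, Ch. VIII §12 (8.12.10)] -/
theorem hasDerivAt_fderiv_comp_curve {Θ : E → F} (hΘ : ContDiff ℝ 2 Θ) {m : ℝ → E} {m' : E} {t : ℝ} (hm : HasDerivAt m m' t) :
    HasDerivAt (fun s => fderiv ℝ Θ (m s)) (fderiv ℝ (fderiv ℝ Θ) (m t) m') t := by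
  have h1 : ContDiff ℝ 1 (fderiv ℝ Θ) := hΘ.fderiv_right (m := 1) le_rfl
  exact ((h1.differentiable one_ne_zero).differentiableAt.hasFDerivAt).comp_hasDerivAt t hm

/-- **Order one**: `(d∕dt) DΘ(m(t))[y(t)] = D²Θ(m)[m′][y] + DΘ(m)[y′]` for `Θ ∈ C²`. [cite: Dieudonne1960, Ch. VIII §1 (8.1.4), §12 (8.12.10)] -/
theorem hasDerivAt_fderiv_apply_curves {Θ : E → F} (hΘ : ContDiff ℝ 2 Θ) {m y : ℝ → E} {m' y' : E} {t : ℝ}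
    (hm : HasDerivAt m m' t) (hy : HasDerivAt y y' t) :
    HasDerivAt (fun s => fderiv ℝ Θ (m s) (y s)) (fderiv ℝ (fderiv ℝ Θ) (m t) m' (y t) + fderiv ℝ Θ (m t) y') t :=
  (hasDerivAt_fderiv_comp_curve hΘ hm).clm_apply hy

/-- The curve of operators `t ↦ D²Θ(m(t))` (nested) has derivative `D³Θ(m(t))[m′]` for `Θ ∈ C³`. [cite: Dieudonne1960, Ch. VIII §12 (8.12.10)] -/
theorem hasDerivAt_nestedFDeriv_two_comp_curve {Θ : E → F} (hΘ : ContDiff ℝ 3 Θ) {m : ℝ → E} {m' : E} {t : ℝ} (hm : HasDerivAt m m' t) :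
    HasDerivAt (fun s => fderiv ℝ (fderiv ℝ Θ) (m s)) (fderiv ℝ (fderiv ℝ (fderiv ℝ Θ)) (m t) m') t := by
  letI i2 : NormedAddCommGroup (E →L[ℝ] E →L[ℝ] F) := inferInstance
  letI : NormedSpace ℝ (E →L[ℝ] E →L[ℝ] F) := inferInstance
  have h2 : ContDiff ℝ 2 (fderiv ℝ Θ) := hΘ.fderiv_right (m := 2) (by norm_cast)
  have h1 : ContDiff ℝ 1 (fderiv ℝ (fderiv ℝ Θ)) := h2.fderiv_right (m := 1) (by norm_cast)
  exact ((h1.differentiable one_ne_zero).differentiableAt.hasFDerivAt).comp_hasDerivAt t hm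

/-- **Order two**: `(d∕dt) D²Θ(m(t))[y₁(t)][y₂(t)] = D³Θ(m)[m′][y₁][y₂] + D²Θ(m)[y₁′][y₂] + D²Θ(m)[y₁][y₂′]` for `Θ ∈ C³`.
[cite: Dieudonne1960, Ch. VIII §1 (8.1.4), §12 (8.12.10)] -/
theorem hasDerivAt_nestedFDeriv_two_apply_curves {Θ : E → F} (hΘ : ContDiff ℝ 3 Θ) {m y₁ y₂ : ℝ → E} {m' y₁' y₂' : E} {t : ℝ}
    (hm : HasDerivAt m m' t) (hy₁ : HasDerivAt y₁ y₁' t) (hy₂ : HasDerivAt y₂ y₂' t) :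
    HasDerivAt (fun s => fderiv ℝ (fderiv ℝ Θ) (m s) (y₁ s) (y₂ s))
      (fderiv ℝ (fderiv ℝ (fderiv ℝ Θ)) (m t) m' (y₁ t) (y₂ t) + fderiv ℝ (fderiv ℝ Θ) (m t) y₁' (y₂ t) +
        fderiv ℝ (fderiv ℝ Θ) (m t) (y₁ t) y₂') t := by
  letI i2 : NormedAddCommGroup (E →L[ℝ] E →L[ℝ] F) := inferInstance
  letI : NormedSpace ℝ (E →L[ℝ] E →L[ℝ] F) := inferInstance
  have h := ((hasDerivAt_nestedFDeriv_two_comp_curve hΘ hm).clm_apply hy₁).clm_apply hy₂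
  refine h.congr_deriv ?_
  rfl

/-- The curve of operators `t ↦ D³Θ(m(t))` (nested) has derivative `D⁴Θ(m(t))[m′]` for `Θ ∈ C⁴`. [cite: Dieudonne1960, Ch. VIII §12 (8.12.10)] -/
theorem hasDerivAt_nestedFDeriv_three_comp_curve {Θ : E → F} (hΘ : ContDiff ℝ 4 Θ) {m : ℝ → E} {m' : E} {t : ℝ} (hm : HasDerivAt m m' t) :
    HasDerivAt (fun s => fderiv ℝ (fderiv ℝ (fderiv ℝ Θ)) (m s)) (fderiv ℝ (fderiv ℝ (fderiv ℝ (fderiv ℝ Θ))) (m t) m') t := by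
  letI i2 : NormedAddCommGroup (E →L[ℝ] E →L[ℝ] F) := inferInstance
  letI : NormedSpace ℝ (E →L[ℝ] E →L[ℝ] F) := inferInstance
  letI i3 : NormedAddCommGroup (E →L[ℝ] E →L[ℝ] E →L[ℝ] F) := inferInstance
  letI : NormedSpace ℝ (E →L[ℝ] E →L[ℝ] E →L[ℝ] F) := inferInstance
  have h3 : ContDiff ℝ 3 (fderiv ℝ Θ) := hΘ.fderiv_right (m := 3) (by norm_cast)
  have h2 : ContDiff ℝ 2 (fderiv ℝ (fderiv ℝ Θ)) := h3.fderiv_right (m := 2) (by norm_cast)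
  have h1 : ContDiff ℝ 1 (fderiv ℝ (fderiv ℝ (fderiv ℝ Θ))) := h2.fderiv_right (m := 1) (by norm_cast)
  exact ((h1.differentiable one_ne_zero).differentiableAt.hasFDerivAt).comp_hasDerivAt t hm

/-- **Order three**: `(d∕dt) D³Θ(m(t))[y₁(t)][y₂(t)][y₃(t)] = D⁴Θ(m)[m′][y₁][y₂][y₃] + D³Θ(m)[y₁′][y₂][y₃] + D³Θ(m)[y₁][y₂′][y₃] + D³Θ(m)[y₁][y₂][y₃′]`
for `Θ ∈ C⁴`. [cite: Dieudonne1960, Ch. VIII §1 (8.1.4), §12 (8.12.10)] -/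
theorem hasDerivAt_nestedFDeriv_three_apply_curves {Θ : E → F} (hΘ : ContDiff ℝ 4 Θ) {m y₁ y₂ y₃ : ℝ → E} {m' y₁' y₂' y₃' : E} {t : ℝ}
    (hm : HasDerivAt m m' t) (hy₁ : HasDerivAt y₁ y₁' t) (hy₂ : HasDerivAt y₂ y₂' t) (hy₃ : HasDerivAt y₃ y₃' t) :
    HasDerivAt (fun s => fderiv ℝ (fderiv ℝ (fderiv ℝ Θ)) (m s) (y₁ s) (y₂ s) (y₃ s))
      (fderiv ℝ (fderiv ℝ (fderiv ℝ (fderiv ℝ Θ))) (m t) m' (y₁ t) (y₂ t) (y₃ t) + fderiv ℝ (fderiv ℝ (fderiv ℝ Θ)) (m t) y₁' (y₂ t) (y₃ t) +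
        fderiv ℝ (fderiv ℝ (fderiv ℝ Θ)) (m t) (y₁ t) y₂' (y₃ t) + fderiv ℝ (fderiv ℝ (fderiv ℝ Θ)) (m t) (y₁ t) (y₂ t) y₃') t := by
  letI i2 : NormedAddCommGroup (E →L[ℝ] E →L[ℝ] F) := inferInstance
  letI : NormedSpace ℝ (E →L[ℝ] E →L[ℝ] F) := inferInstance
  letI i3 : NormedAddCommGroup (E →L[ℝ] E →L[ℝ] E →L[ℝ] F) := inferInstance
  letI : NormedSpace ℝ (E →L[ℝ] E →L[ℝ] E →L[ℝ] F) := inferInstance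
  have h := (((hasDerivAt_nestedFDeriv_three_comp_curve hΘ hm).clm_apply hy₁).clm_apply hy₂).clm_apply hy₃
  refine h.congr_deriv ?_
  rfl

end Literature.Analysis.Calculus

end
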